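import Literature.AnabelianGeometry.SemiGraphs.ArithmeticCoverings
import HarnessLib

/-!
# [SemiAnbd] Def 5.1 (iii)/(iv): morphisms of (possibly disconnected) arithmetic semi-graphs of
# anabelioids — NON-VACUITY of the interface `ArithFamilyHom` (abc-iut L3 inhabitation census v1,
# row `ArithFamilyHom`: zero producers)

Mochizuki, *Semi-graphs of anabelioids*, Publ. RIMS **42** (2006), §5, Definition 5.1 (iii), (iv), p. 63
(PRIMS p. 283) [cite: MochizukiSemiAnbd2006, Def 5.1 (iv) p.63]: an arithmetic semi-graph of anabelioids is a
disjoint union of connected ones, and a morphism is a family of morphisms of connected components over a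
map of index sets.  abc-iut-L3-t3's record `ArithFamilyHom 𝔉' 𝔉` (`ArithmeticCoverings.lean`: `toComp` +
componentwise `ArithHom`) had no producer in the tree, although the connected `ArithHom` has `id`/`comp`.

PROOF-ONLY file (abc-iut cell, wave-4 prover abc-iut-w4-d098; no `def`/`instance`/`structure` declared):
* `ArithFamilyHom.nonempty_id 𝔉` — the IDENTITY morphism of any family (`toComp := id`, components
  `ArithHom.id`) — GENUINE;
* `ArithFamilyHom.nonempty_comp` — families of morphisms COMPOSE (over the composite index map, components
  `ArithHom.comp`), so the interface is closed under composition;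
* `ArithFamilyHom.nonempty_of_arithHom` — a connected morphism `𝔊' → 𝔊` gives a morphism of the one-component
  families (`ArithSemiGraphFamily.single`).
Plain bookkeeping; nothing here bears on [IUTchIII] Cor. 3.12.
-/

namespace Literature.AnabelianGeometry.SemiGraphs

open CategoryTheory

universe u v w

variable {Obj : Type u} [Category.{v} Obj] {𝓥 : SemiAnbdVocab.{u, v, w} Obj}

/-- **Identity morphism of an arithmetic semi-graph family** (Def 5.1 (iv)). GENUINE witness.
[cite: MochizukiSemiAnbd2006, Def 5.1 (iv) p.63] -/
theorem ArithFamilyHom.nonempty_id (𝔉 : ArithSemiGraphFamily 𝓥) : Nonempty (ArithFamilyHom 𝓥 𝔉 𝔉) :=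
  ⟨{ toComp := id, hom := fun i => ArithHom.id (𝔉.comp i) }⟩

/-- **Composition of morphisms of families** (Def 5.1 (iv)): over `toComp ψ ∘ toComp φ`, componentwise
`ArithHom.comp`. [cite: MochizukiSemiAnbd2006, Def 5.1 (iv) p.63] -/
theorem ArithFamilyHom.nonempty_comp {𝔉₁ 𝔉₂ 𝔉₃ : ArithSemiGraphFamily 𝓥} (φ : ArithFamilyHom 𝓥 𝔉₁ 𝔉₂)
    (ψ : ArithFamilyHom 𝓥 𝔉₂ 𝔉₃) :
    ∃ χ : ArithFamilyHom 𝓥 𝔉₁ 𝔉₃, χ.toComp = ψ.toComp ∘ φ.toComp :=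
  ⟨{ toComp := ψ.toComp ∘ φ.toComp, hom := fun i => (φ.hom i).comp (ψ.hom (φ.toComp i)) }, rfl⟩

/-- A morphism of CONNECTED arithmetic semi-graphs of anabelioids is a morphism of the corresponding
one-component families (`ArithSemiGraphFamily.single`). [cite: MochizukiSemiAnbd2006, Def 5.1 (iii)(iv) p.63] -/
theorem ArithFamilyHom.nonempty_of_arithHom {𝔊' 𝔊 : ArithSemiGraph 𝓥} (φ : ArithHom 𝓥 𝔊' 𝔊) :
    Nonempty (ArithFamilyHom 𝓥 (ArithSemiGraphFamily.single 𝔊') (ArithSemiGraphFamily.single 𝔊)) :=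
  ⟨{ toComp := id, hom := fun _ => φ }⟩

end Literature.AnabelianGeometry.SemiGraphs
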